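import Summits.Langlands.Langlands.Theses.QuarterDeficit1951

/-!
# `CorrespondentFingerprint` (stmt-Langlands-15898) — negative knowledge I: the refutation shape
# of a closed conclusion, and what the crux says modulo the route's bet

Support lemmas of the standing disprover (`Cruxes/CorrespondentFingerprint/Disproof.lean`, cycle 1,
findings 1 and 3; refuter-cdisprove-stmt-Langlands-15898-0, 2026-08-16).

The crux `Summit.Langlands.Langlands.Theses.QuarterDeficit1951.CorrespondentFingerprint` (C2a of
route `QuarterDeficit1951`) has the shape `∀ RD ℓ ι hcpt π ρ, hyps → W` where the conclusion `W`
("an order-5 `χ mod 1951` and a non-zero weight-0 Maass cusp form on `(Γ₀(1951), χ)` with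
`λ = 1/4` and the exact icosahedral Hecke fingerprint at `p ≤ 13`") mentions NONE of the bound
variables.  Two formal consequences, recorded here so that planners, ideators and provers can
import them:

* `not_correspondentFingerprint_iff` — **refutation normal form**: `¬ C2a` holds iff SOME full
  all-places correspondent `(RD, ℓ ≥ 17, ℓ ≠ 1951, ι, π, ρ)` of an even icosahedral conductor-1951
  `ρ` exists AND no fingerprinted `λ = 1/4` form exists for any order-5 character.  The second
  conjunct is the negation of what strong Artin predicts for the four Doud–Moore representations;
  the first is the reciprocity law for such a `ρ`.  Consequently every hypothesis-dropping variant of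
  C2a is implied by `W` alone: the hypotheses are load-bearing for the PROOF, not for the truth
  value, and no `_false_without_<H>` lemma can exist short of refuting `W`.
* `correspondentFingerprint_iff_noCorrespondent_of_deficit` — **modulo the route's bet**
  `QuarterFingerprintDeficit` (C1), C2a is EQUIVALENT to "no such correspondent exists" (because
  `W` itself refutes C1: `λ = 1/4` lies in the window and exact fingerprint membership is within
  `1/100`, `not_quarterFingerprintDeficit_of_witness`).

Nothing here asserts a route statement.  Mathlib + the route file only. [folklore]
-/

noncomputable section

-- single-conjunct summit `Summits/Langlands/Langlands` (D-0017): the doubled namespace is the tree's layout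
set_option linter.dupNamespace false

open scoped MatrixGroups
open Summit.Langlands Summit.Langlands.Langlands.Theses.QuarterDeficit1951
open Literature.NumberTheory.Automorphic Literature.NumberTheory.GaloisRepresentations

namespace Summit.Langlands.Langlands.Theorems.CorrespondentFingerprint.Negative

/-- **The conclusion of C2a refutes C1.**  If, for some order-5 `χ mod 1951`, a non-zero weight-0
Maass cusp form `u` on `(Γ₀(1951), χ)` with `λ = 1/4` exactly and exact fingerprint
`μ_p² χ̄(p) ∈ {0, 1, 4, (3 ± √5)/2}` at `p ≤ 13` exists (the literal conclusion of
`CorrespondentFingerprint`), then `QuarterFingerprintDeficit` fails (the window `|λ - 1/4| ≤ 1/100`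
contains `1/4`, and exact membership is membership within `1/100`). [folklore] -/
theorem not_quarterFingerprintDeficit_of_witness
    (hW : ∃ χ : DirichletCharacter ℂ 1951, orderOf χ = 5 ∧ ∃ u : UpperHalfPlane → ℂ,
      (IsC2 u ∧ (∀ z, hypLaplacian u z + (((1 / 4 : ℝ)) : ℂ) * u z = 0) ∧
        (∀ γ : SL(2, ℤ), γ ∈ CongruenceSubgroup.Gamma0 1951 →
          ∀ z : UpperHalfPlane, u (γ • z) = χ ((γ 1 1 : ℤ) : ZMod 1951) * u z) ∧
        (∀ y : ℝ, 0 < y →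
          ∫ x in (0 : ℝ)..1, u (UpperHalfPlane.ofComplex (x + y * Complex.I)) = 0) ∧
        (∀ y : ℝ, 0 < y → ∫ x in (0 : ℝ)..1951,
          u (ModularGroup.S • UpperHalfPlane.ofComplex (x + y * Complex.I)) = 0) ∧
        (∃ C : ℝ, ∀ z, ‖u z‖ ≤ C)) ∧
      (∃ z, u z ≠ 0) ∧
      ∀ p ∈ ({2, 3, 5, 7, 11, 13} : Finset ℕ), ∃ μ φ : ℂ,
        φ ∈ ({0, 1, 4, (((3 + Real.sqrt 5) / 2 : ℝ) : ℂ), (((3 - Real.sqrt 5) / 2 : ℝ) : ℂ)} :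
          Set ℂ) ∧
        (∀ z : UpperHalfPlane, ((Real.sqrt p : ℝ) : ℂ)⁻¹ *
            ((∑ b ∈ Finset.range p, u (UpperHalfPlane.ofComplex (((z : ℂ) + b) / p))) +
              χ (p : ZMod 1951) * u (UpperHalfPlane.ofComplex ((p : ℂ) * z))) = μ * u z) ∧
        μ ^ 2 * (starRingEnd ℂ) (χ (p : ZMod 1951)) = φ) :
    ¬ QuarterFingerprintDeficit := by
  intro hQ
  obtain ⟨χ, hχ, u, hform, hne, hfp⟩ := hW
  refine hQ χ hχ ⟨u, 1 / 4, hform, hne, by norm_num, fun p hp => ?_⟩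
  obtain ⟨μ, φ, hφ, hT, hμ⟩ := hfp p hp
  exact ⟨μ, φ, hφ, hT, by rw [hμ, sub_self, norm_zero]; norm_num⟩

/-- **Refutation normal form of C2a.**  `CorrespondentFingerprint` fails iff (i) there EXIST
reciprocity data `RD`, a prime `ℓ ≥ 17`, `ℓ ≠ 1951`, `ι : ℚ̄_ℓ ≃ ℂ`, a cuspidal L-algebraic `π`
of `GL₂(𝔸_ℚ)` and an irreducible finite-image even `ρ` of conductor `1951` with order-5
determinant and icosahedral Frobenius data away from `1951`, corresponding at all places, AND
(ii) there is NO order-5 `χ mod 1951` carrying a non-zero `λ = 1/4` weight-0 Maass cusp form with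
the exact fingerprint at `p ≤ 13`.  (The conclusion of the crux is closed, so the crux is
`(i) → ¬(ii)`.)  Any disproof must therefore settle the Doud–Moore reciprocity instance (i) and the
non-existence (ii) — the latter contradicts strong Artin. [folklore] -/
theorem not_correspondentFingerprint_iff :
    ¬ CorrespondentFingerprint ↔
      ((∃ (RD : ReciprocityData ℚ) (ℓ : ℕ) (_ : Fact ℓ.Prime) (ι : PadicAlgCl ℓ ≃+* ℂ)
          (hcpt : isCompact_glFiniteIntegralLevel 2 ℚ) (π : CuspidalAutomorphicRepData 2 ℚ hcpt)
          (ρ : FramedGaloisRep ℚ (PadicAlgCl ℓ) 2),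
          17 ≤ ℓ ∧ ℓ ≠ 1951 ∧
            (ρ.toGaloisRep.IsIrreducible ∧ (Set.range ρ).Finite ∧ ρ.IsEven ∧
              ρ.toGaloisRep.artinConductorNat = 1951 ∧
              ∃ χ₀ : DirichletCharacter ℂ 1951, orderOf χ₀ = 5 ∧
                ∀ v : IsDedekindDomain.HeightOneSpectrum (NumberField.RingOfIntegers ℚ),
                  v.residueCard ≠ 1951 → ρ.IsUnramifiedAt v ∧ ∃ t d : PadicAlgCl ℓ,
                    ρ.HasFrobCharpolyAt v
                        (Polynomial.X ^ 2 - Polynomial.C t * Polynomial.X + Polynomial.C d) ∧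
                      ι d = (χ₀ (v.residueCard : ZMod 1951))⁻¹ ∧
                      (t ^ 2 = 0 ∨ t ^ 2 = d ∨ t ^ 2 = 4 * d ∨
                        t ^ 4 - 3 * d * t ^ 2 + d ^ 2 = 0)) ∧
            π.1.IsLAlgebraic ∧ Corresponds RD ι π.1 ρ) ∧
        ¬ ∃ χ : DirichletCharacter ℂ 1951, orderOf χ = 5 ∧ ∃ u : UpperHalfPlane → ℂ,
          (IsC2 u ∧ (∀ z, hypLaplacian u z + (((1 / 4 : ℝ)) : ℂ) * u z = 0) ∧
            (∀ γ : SL(2, ℤ), γ ∈ CongruenceSubgroup.Gamma0 1951 →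
              ∀ z : UpperHalfPlane, u (γ • z) = χ ((γ 1 1 : ℤ) : ZMod 1951) * u z) ∧
            (∀ y : ℝ, 0 < y →
              ∫ x in (0 : ℝ)..1, u (UpperHalfPlane.ofComplex (x + y * Complex.I)) = 0) ∧
            (∀ y : ℝ, 0 < y → ∫ x in (0 : ℝ)..1951,
              u (ModularGroup.S • UpperHalfPlane.ofComplex (x + y * Complex.I)) = 0) ∧
            (∃ C : ℝ, ∀ z, ‖u z‖ ≤ C)) ∧
          (∃ z, u z ≠ 0) ∧
          ∀ p ∈ ({2, 3, 5, 7, 11, 13} : Finset ℕ), ∃ μ φ : ℂ,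
            φ ∈ ({0, 1, 4, (((3 + Real.sqrt 5) / 2 : ℝ) : ℂ), (((3 - Real.sqrt 5) / 2 : ℝ) : ℂ)} :
              Set ℂ) ∧
            (∀ z : UpperHalfPlane, ((Real.sqrt p : ℝ) : ℂ)⁻¹ *
                ((∑ b ∈ Finset.range p, u (UpperHalfPlane.ofComplex (((z : ℂ) + b) / p))) +
                  χ (p : ZMod 1951) * u (UpperHalfPlane.ofComplex ((p : ℂ) * z))) = μ * u z) ∧
            μ ^ 2 * (starRingEnd ℂ) (χ (p : ZMod 1951)) = φ) := by
  constructor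
  · intro h
    by_contra hc
    rw [not_and, not_not] at hc
    apply h
    intro RD ℓ hℓ ι hcpt π ρ h17 hne hG hL hC
    exact hc ⟨RD, ℓ, hℓ, ι, hcpt, π, ρ, h17, hne, hG, hL, hC⟩
  · rintro ⟨⟨RD, ℓ, hℓ, ι, hcpt, π, ρ, h17, hne, hG, hL, hC⟩, hW⟩ h
    exact hW (h RD ℓ ι hcpt π ρ h17 hne hG hL hC)

/-- **Modulo the route's bet C1, C2a is "no correspondent".**  Under `QuarterFingerprintDeficit`,
`CorrespondentFingerprint` holds iff NO `(RD, ℓ ≥ 17, ℓ ≠ 1951, ι, π, ρ)` as in its hypotheses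
exists — i.e. no cuspidal L-algebraic `π` of `GL₂(𝔸_ℚ)` corresponds at all places, for any
reciprocity data, to any irreducible finite-image even conductor-1951 `ρ` with order-5 determinant
and icosahedral Frobenius data (the contrapositive of the route's intended chain: such a
correspondent would yield the window form that C1 forbids). [folklore] -/
theorem correspondentFingerprint_iff_noCorrespondent_of_deficit (hQ : QuarterFingerprintDeficit) :
    CorrespondentFingerprint ↔
      ¬ ∃ (RD : ReciprocityData ℚ) (ℓ : ℕ) (_ : Fact ℓ.Prime) (ι : PadicAlgCl ℓ ≃+* ℂ)
          (hcpt : isCompact_glFiniteIntegralLevel 2 ℚ) (π : CuspidalAutomorphicRepData 2 ℚ hcpt)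
          (ρ : FramedGaloisRep ℚ (PadicAlgCl ℓ) 2),
          17 ≤ ℓ ∧ ℓ ≠ 1951 ∧
            (ρ.toGaloisRep.IsIrreducible ∧ (Set.range ρ).Finite ∧ ρ.IsEven ∧
              ρ.toGaloisRep.artinConductorNat = 1951 ∧
              ∃ χ₀ : DirichletCharacter ℂ 1951, orderOf χ₀ = 5 ∧
                ∀ v : IsDedekindDomain.HeightOneSpectrum (NumberField.RingOfIntegers ℚ),
                  v.residueCard ≠ 1951 → ρ.IsUnramifiedAt v ∧ ∃ t d : PadicAlgCl ℓ,
                    ρ.HasFrobCharpolyAt v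
                        (Polynomial.X ^ 2 - Polynomial.C t * Polynomial.X + Polynomial.C d) ∧
                      ι d = (χ₀ (v.residueCard : ZMod 1951))⁻¹ ∧
                      (t ^ 2 = 0 ∨ t ^ 2 = d ∨ t ^ 2 = 4 * d ∨
                        t ^ 4 - 3 * d * t ^ 2 + d ^ 2 = 0)) ∧
            π.1.IsLAlgebraic ∧ Corresponds RD ι π.1 ρ := by
  constructor
  · rintro h ⟨RD, ℓ, hℓ, ι, hcpt, π, ρ, h17, hne, hG, hL, hC⟩
    exact not_quarterFingerprintDeficit_of_witness (h RD ℓ ι hcpt π ρ h17 hne hG hL hC) hQ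
  · intro h RD ℓ hℓ ι hcpt π ρ h17 hne hG hL hC
    exact (h ⟨RD, ℓ, hℓ, ι, hcpt, π, ρ, h17, hne, hG, hL, hC⟩).elim

end Summit.Langlands.Langlands.Theorems.CorrespondentFingerprint.Negative

end
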